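import Summits.KontsevichZagierPeriods.KontsevichZagierPeriods.Cruxes.ExactDescentBox.ExactDescentBoxProofCube

/-!
# `ExactDescentBox` (stmt-KontsevichZagierPeriods-4427, route GenericPointClass) — part 2/3: the three statements of line `affine_cube`, `OpenBoxToCube` (proved), cube helpers

Part of the complete candidate proof `Cruxes/ExactDescentBox/ExactDescentBoxProof.lean` (strategist seat
planner-cstrat-stmt-KontsevichZagierPeriods-4427-s2-0, 2026-08-17; lean check rc 0, 0 sorry, axioms std), pre-split into
three ≤ 400-line files for landing as `Theorems/GenericPointClassExactDescentBox{Cube,Aux,}.lean` (PROVER: rename the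
module paths in the `import` lines accordingly; nothing else changes).

§1 `openBoxToCube_proof` (affine cubification of an open box with algebraic corners, one rule-(2) move); §2 coordinate
cycles on the unit cube and honest face representations.

References: M. Kontsevich, D. Zagier, *Periods* (2001), §1.2, rules (1)–(3); A. Huber, S. Müller-Stach, *Periods and
Nori Motives* (2017), §13.1; J. Bochnak, M. Coste, M.-F. Roy, *Real Algebraic Geometry* (1998), §2.2.
-/

noncomputable section

open MeasureTheory Set
open Literature.NumberTheory.Transcendental
open Literature.NumberTheory.Transcendental.KZ (IntegralRep of relations changeOfVariablesRel_subset_relations)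
open Literature.ModelTheory.ExponentialFields (IsSemialgebraic)
open Summit.KontsevichZagierPeriods.GaussManinCertificates
  (isAlgebraic_corner_of_isSemialgebraic_openBox isSemialgebraic_openBox_of_isAlgebraic)
open Summit.KontsevichZagierPeriods.KontsevichZagierPeriods.Cruxes.StokesGeneration.FibrewiseStokes
  (boxAff_isSemialgebraicMapOn boxAff_isAlgebraic_prod boxAff_injective boxAff_diag_det boxAff_hasFDerivAt)

namespace Summit.KontsevichZagierPeriods.GenericPointClass.ExactDescentBox

/-! ### The three statements of line `affine_cube` -/

/-- **Affine cubification of an OPEN box with algebraic corners (one rule-(2) move).** A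
representation `r` on the open box `∏ᵢ (lᵢ, uᵢ)` (`lᵢ < uᵢ` real algebraic) is congruent modulo
`KZ.relations` to an open-unit-cube representation `t` with integrand
`(∏ᵢ (uᵢ − lᵢ)) · r.integrand (l + (u − l)·x)` (the chart `x ↦ l + (u − l)·x`, constant Jacobian
`∏ᵢ (uᵢ − lᵢ) > 0`). Open-box twin of the landed `StokesGeneration.FibrewiseStokes.stub_boxToCube`. -/
def OpenBoxToCube : Prop :=
  ∀ (N : ℕ) (l u : Fin N → ℝ) (r : KZ.IntegralRep N), (∀ i, IsAlgebraic ℚ (l i)) →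
    (∀ i, IsAlgebraic ℚ (u i)) → (∀ i, l i < u i) →
    r.domain = {x | ∀ i, x i ∈ Set.Ioo (l i) (u i)} →
    ∃ t : KZ.IntegralRep N, t.domain = {x | ∀ i, x i ∈ Set.Ioo (0 : ℝ) 1} ∧
      (∀ x ∈ t.domain,
        t.integrand x = (∏ i, (u i - l i)) * r.integrand (fun i => l i + (u i - l i) * x i)) ∧
      KZ.of r - KZ.of t ∈ KZ.relations

/-- **Cycling a coordinate of the open unit cube to the last slot is a move** — VERBATIM the
statement of item stmt-KontsevichZagierPeriods-17772 (`CobordismMove.CubeCoordinateCycle`), proved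
in `Cruxes/CubeStokes/CubeStokesProof.lean` §2. -/
def CubeCoordinateCycle : Prop :=
  ∀ (d : ℕ) (k : Fin (d + 1)) (R R' : Literature.NumberTheory.Transcendental.KZ.IntegralRep (d + 1)),
    R.domain = {x : Fin (d + 1) → ℝ | ∀ i, x i ∈ Set.Ioo (0 : ℝ) 1} →
    R'.domain = {x : Fin (d + 1) → ℝ | ∀ i, x i ∈ Set.Ioo (0 : ℝ) 1} →
    Set.EqOn R'.integrand (fun z => R.integrand (Fin.insertNth k (z (Fin.last d)) (Fin.init z)))
      R'.domain →
    Literature.NumberTheory.Transcendental.KZ.of R - Literature.NumberTheory.Transcendental.KZ.of R' ∈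
      Literature.NumberTheory.Transcendental.KZ.relations

/-- **Newton–Leibniz along the last coordinate of the open unit cube, bulk term included** —
VERBATIM the statement of item stmt-KontsevichZagierPeriods-17771
(`CobordismMove.CubeLastNewtonLeibniz`), proved in `Cruxes/CubeStokes/CubeStokesProof.lean` §3. -/
def CubeLastNewtonLeibniz : Prop :=
  ∀ (d : ℕ) (A A' : (Fin (d + 1) → ℝ) → ℝ)
    (R : Literature.NumberTheory.Transcendental.KZ.IntegralRep (d + 1))
    (r₀ r₁ : Literature.NumberTheory.Transcendental.KZ.IntegralRep d),
    Literature.NumberTheory.Transcendental.IsSemialgebraicFunOn ℚ (Set.Icc (0 : Fin (d + 1) → ℝ) 1) A →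
    ContinuousOn A (Set.Icc (0 : Fin (d + 1) → ℝ) 1) →
    (∀ y ∈ {y : Fin d → ℝ | ∀ i, y i ∈ Set.Ioo (0 : ℝ) 1}, ∀ t ∈ Set.Ioo (0 : ℝ) 1,
      HasDerivAt (fun s : ℝ => A (Fin.snoc y s)) (A' (Fin.snoc y t)) t) →
    R.domain = {x : Fin (d + 1) → ℝ | ∀ i, x i ∈ Set.Ioo (0 : ℝ) 1} →
    Set.EqOn R.integrand A' R.domain →
    r₀.domain = {y : Fin d → ℝ | ∀ i, y i ∈ Set.Ioo (0 : ℝ) 1} →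
    r₁.domain = {y : Fin d → ℝ | ∀ i, y i ∈ Set.Ioo (0 : ℝ) 1} →
    Set.EqOn r₀.integrand (fun y => A (Fin.snoc y 0)) r₀.domain →
    Set.EqOn r₁.integrand (fun y => A (Fin.snoc y 1)) r₁.domain →
    Literature.NumberTheory.Transcendental.KZ.of R - Literature.NumberTheory.Transcendental.KZ.of r₁ +
      Literature.NumberTheory.Transcendental.KZ.of r₀ ∈
        Literature.NumberTheory.Transcendental.KZ.relations

/-- `CubeCoordinateCycle` holds: the cube engine, piece stmt-17772 (§0a). [cite: KontsevichZagier2001, §1.2 rule (2)] -/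
theorem cubeCoordinateCycle_holds : CubeCoordinateCycle :=
  CubeCoordinateCycle.cubeCoordinateCycle_proof

/-- `CubeLastNewtonLeibniz` holds: the cube engine, piece stmt-17771 (§0b). [cite: KontsevichZagier2001, §1.2 rule (3)] -/
theorem cubeLastNewtonLeibniz_holds : CubeLastNewtonLeibniz :=
  CubeLastNewtonLeibniz.cubeLastNewtonLeibniz_proof

/-! ### §1 `OpenBoxToCube` (stub 1 of the line) -/

/-- The affine chart maps the open unit cube ONTO the open box `Π (lᵢ, uᵢ)` (`lᵢ < uᵢ`; preimage
point `((yᵢ − lᵢ)/(uᵢ − lᵢ))ᵢ`). [folklore] -/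
theorem boxAff_image_openCube {N : ℕ} {l u : Fin N → ℝ} (hlu : ∀ i, l i < u i) :
    (fun y : Fin N → ℝ => fun i => l i + (u i - l i) * y i) ''
        {x : Fin N → ℝ | ∀ i, x i ∈ Set.Ioo (0:ℝ) 1} =
      {x : Fin N → ℝ | ∀ i, x i ∈ Set.Ioo (l i) (u i)} := by
  ext y
  simp only [mem_image, mem_setOf_eq, mem_Ioo]
  constructor
  · rintro ⟨x, hx, rfl⟩ i
    obtain ⟨h0, h1⟩ := hx i
    have hd : 0 < u i - l i := sub_pos.mpr (hlu i)
    constructor <;> nlinarith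
  · intro hy
    refine ⟨fun i => (y i - l i) / (u i - l i), fun i => ?_, ?_⟩
    · have hd : 0 < u i - l i := sub_pos.mpr (hlu i)
      obtain ⟨h0, h1⟩ := hy i
      exact ⟨div_pos (by linarith) hd, (div_lt_one hd).mpr (by linarith)⟩
    · funext i
      have hd : u i - l i ≠ 0 := (sub_pos.mpr (hlu i)).ne'
      field_simp
      ring

/-- **`OpenBoxToCube`** (stub 1 of line `affine_cube`): affine cubification of an open box with
algebraic corners is one rule-(2) move. [cite: KontsevichZagier2001, §1.2 rule (2)] -/
theorem openBoxToCube_proof : OpenBoxToCube := by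
  intro N l u r hl hu hlu hdom
  -- the open unit cube
  have hC : IsSemialgebraic ℚ {x : Fin N → ℝ | ∀ i, x i ∈ Set.Ioo (0:ℝ) 1} :=
    KZ.isSemialgebraic_unitCube N
  have hCmeas : MeasurableSet {x : Fin N → ℝ | ∀ i, x i ∈ Set.Ioo (0:ℝ) 1} :=
    (KZ.isOpen_unitCube N).measurableSet
  -- the chart: semialgebraic, injective, onto the box, derivative of determinant `Π (uᵢ − lᵢ) > 0`
  have himage := boxAff_image_openCube hlu
  have hdom' : r.domain = (fun y : Fin N → ℝ => fun i => l i + (u i - l i) * y i) ''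
      {x : Fin N → ℝ | ∀ i, x i ∈ Set.Ioo (0:ℝ) 1} := hdom.trans himage.symm
  have hmaps : MapsTo (fun y : Fin N → ℝ => fun i => l i + (u i - l i) * y i)
      {x : Fin N → ℝ | ∀ i, x i ∈ Set.Ioo (0:ℝ) 1} r.domain := by
    rw [hdom']
    exact mapsTo_image _ _
  have hsa := boxAff_isSemialgebraicMapOn hC hl hu
  have hinj : InjOn (fun y : Fin N → ℝ => fun i => l i + (u i - l i) * y i)
      {x : Fin N → ℝ | ∀ i, x i ∈ Set.Ioo (0:ℝ) 1} := (boxAff_injective hlu).injOn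
  have hdet : |(LinearMap.toContinuousLinearMap
      (Matrix.toLin' (Matrix.diagonal fun i => u i - l i))).det| = ∏ i, (u i - l i) := by
    rw [boxAff_diag_det]
    exact abs_of_pos (Finset.prod_pos fun i _ => sub_pos.mpr (hlu i))
  -- the cube integrand `(Π (uᵢ − lᵢ)) · (r.integrand ∘ Φ)`: semialgebraic and integrable
  have hcomp : IsSemialgebraicFunOn ℚ {x : Fin N → ℝ | ∀ i, x i ∈ Set.Ioo (0:ℝ) 1}
      (r.integrand ∘ fun y : Fin N → ℝ => fun i => l i + (u i - l i) * y i) :=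
    IsSemialgebraicFunOn.comp_isSemialgebraicMapOn_holds r.isSemialgebraicFunOn_integrand hsa hmaps
  have hg_sa : IsSemialgebraicFunOn ℚ {x : Fin N → ℝ | ∀ i, x i ∈ Set.Ioo (0:ℝ) 1}
      (fun x => (∏ i, (u i - l i)) * r.integrand (fun i => l i + (u i - l i) * x i)) :=
    (isSemialgebraicFunOn_const_of_isAlgebraic hC (boxAff_isAlgebraic_prod hl hu)).fun_mul hcomp
  have hg_int : IntegrableOn
      (fun x => (∏ i, (u i - l i)) * r.integrand (fun i => l i + (u i - l i) * x i))
      {x : Fin N → ℝ | ∀ i, x i ∈ Set.Ioo (0:ℝ) 1} := by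
    have h := (integrableOn_image_iff_integrableOn_abs_det_fderiv_smul volume hCmeas
      (fun x _ => (boxAff_hasFDerivAt l u x).hasFDerivWithinAt) hinj r.integrand).mp
      (hdom' ▸ r.integrableOn)
    refine h.congr_fun (fun x _ => ?_) hCmeas
    simp only [smul_eq_mul, hdet]
  -- the cube representation
  let t : IntegralRep N :=
    ⟨{x : Fin N → ℝ | ∀ i, x i ∈ Set.Ioo (0:ℝ) 1},
      fun x => (∏ i, (u i - l i)) * r.integrand (fun i => l i + (u i - l i) * x i), hC, hg_sa, hg_int⟩
  refine ⟨t, rfl, fun x _ => rfl, ?_⟩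
  -- one change-of-variables move with SOURCE `t` and TARGET `r`
  have hmove : of t - of r ∈ relations := by
    refine changeOfVariablesRel_subset_relations
      ⟨N, t, r, fun y : Fin N → ℝ => fun i => l i + (u i - l i) * y i,
        fun _ => LinearMap.toContinuousLinearMap (Matrix.toLin' (Matrix.diagonal fun i => u i - l i)),
        hsa, fun x _ => (boxAff_hasFDerivAt l u x).hasFDerivWithinAt, hinj, hdom', fun x _ => ?_, rfl⟩
    show (∏ i, (u i - l i)) * r.integrand (fun i => l i + (u i - l i) * x i) =
      r.integrand (fun i => l i + (u i - l i) * x i) * |(LinearMap.toContinuousLinearMap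
        (Matrix.toLin' (Matrix.diagonal fun i => u i - l i))).det|
    rw [hdet, mul_comm]
  rw [← neg_sub]
  exact relations.neg_mem hmove


/-! ### §2 Coordinate cycles on the unit cube; honest face representations -/

variable {d : ℕ}

/-- The coordinate cycle `z ↦ Fin.insertNth k (z last) (Fin.init z)` of `ℝᵈ⁺¹` is a relabelling
of coordinates along an index permutation. [folklore] -/
theorem exists_perm_insertNth (k : Fin (d + 1)) :
    ∃ e : Equiv.Perm (Fin (d + 1)), ∀ z : Fin (d + 1) → ℝ,
      (fun i => z (e i)) = (Fin.insertNth k (z (Fin.last d)) (Fin.init z) : Fin (d + 1) → ℝ) := by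
  refine ⟨(finSuccEquiv' k).trans (finSuccEquiv' (Fin.last d)).symm, fun z => ?_⟩
  funext i
  rcases Fin.eq_self_or_eq_succAbove k i with rfl | ⟨j, rfl⟩
  · simp [finSuccEquiv'_at, finSuccEquiv'_symm_none, Fin.insertNth_apply_same]
  · simp [finSuccEquiv'_succAbove, finSuccEquiv'_symm_some, Fin.insertNth_apply_succAbove,
      Fin.succAbove_last, Fin.init]

/-- The open unit cube is invariant under relabelling coordinates. [folklore] -/
theorem comp_perm_mem_setOf_iff {N : ℕ} (e : Equiv.Perm (Fin N)) (z : Fin N → ℝ) :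
    (fun i => z (e i)) ∈ {x : Fin N → ℝ | ∀ i, x i ∈ Ioo (0 : ℝ) 1} ↔
      z ∈ {x : Fin N → ℝ | ∀ i, x i ∈ Ioo (0 : ℝ) 1} := by
  simp only [mem_setOf_eq]
  exact ⟨fun h i => by simpa using h (e.symm i), fun h i => h (e i)⟩

/-- The closed unit cube is invariant under relabelling coordinates. [folklore] -/
theorem comp_perm_mem_Icc_iff {N : ℕ} (e : Equiv.Perm (Fin N)) (z : Fin N → ℝ) :
    (fun i => z (e i)) ∈ Icc (0 : Fin N → ℝ) 1 ↔ z ∈ Icc (0 : Fin N → ℝ) 1 := by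
  simp only [mem_Icc, Pi.le_def, Pi.zero_apply, Pi.one_apply]
  constructor
  · rintro ⟨h0, h1⟩
    exact ⟨fun i => by simpa using h0 (e.symm i), fun i => by simpa using h1 (e.symm i)⟩
  · rintro ⟨h0, h1⟩
    exact ⟨fun i => h0 (e i), fun i => h1 (e i)⟩

/-- Semialgebraicity on the open unit cube is invariant under relabelling coordinates. [folklore] -/
theorem isSemialgebraicFunOn_comp_perm_setOf {N : ℕ} (e : Equiv.Perm (Fin N))
    {f : (Fin N → ℝ) → ℝ} (hf : IsSemialgebraicFunOn ℚ {x : Fin N → ℝ | ∀ i, x i ∈ Ioo (0 : ℝ) 1} f) :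
    IsSemialgebraicFunOn ℚ {x : Fin N → ℝ | ∀ i, x i ∈ Ioo (0 : ℝ) 1}
      (fun z => f (fun i => z (e i))) := by
  have h := hf.comp_equiv e
  have hset : {w : Fin N → ℝ | (fun i => w (e i)) ∈ {x : Fin N → ℝ | ∀ i, x i ∈ Ioo (0 : ℝ) 1}} =
      {x : Fin N → ℝ | ∀ i, x i ∈ Ioo (0 : ℝ) 1} := by
    ext w
    exact comp_perm_mem_setOf_iff e w
  rwa [hset] at h

/-- Semialgebraicity on the closed unit cube is invariant under relabelling coordinates. [folklore] -/
theorem isSemialgebraicFunOn_comp_perm_Icc {N : ℕ} (e : Equiv.Perm (Fin N))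
    {f : (Fin N → ℝ) → ℝ} (hf : IsSemialgebraicFunOn ℚ (Icc (0 : Fin N → ℝ) 1) f) :
    IsSemialgebraicFunOn ℚ (Icc (0 : Fin N → ℝ) 1) (fun z => f (fun i => z (e i))) := by
  have h := hf.comp_equiv e
  have hset : {w : Fin N → ℝ | (fun i => w (e i)) ∈ Icc (0 : Fin N → ℝ) 1} =
      Icc (0 : Fin N → ℝ) 1 := by
    ext w
    exact comp_perm_mem_Icc_iff e w
  rwa [hset] at h

/-- Relabelling coordinates is continuous. [folklore] -/
theorem continuous_comp_perm {N : ℕ} (e : Equiv.Perm (Fin N)) :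
    Continuous (fun z : Fin N → ℝ => fun i => z (e i)) :=
  continuous_pi fun i => continuous_apply (e i)

/-- Absolute integrability on the open unit cube is invariant under relabelling coordinates (the
relabelling is the volume-preserving `MeasurableEquiv.piCongrLeft` and preserves the cube).
[folklore] -/
theorem integrableOn_comp_perm_setOf {N : ℕ} (e : Equiv.Perm (Fin N)) {f : (Fin N → ℝ) → ℝ}
    (hf : IntegrableOn f {x : Fin N → ℝ | ∀ i, x i ∈ Ioo (0 : ℝ) 1}) :
    IntegrableOn (fun z => f (fun i => z (e i))) {x : Fin N → ℝ | ∀ i, x i ∈ Ioo (0 : ℝ) 1} := by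
  set L : (Fin N → ℝ) ≃ᵐ (Fin N → ℝ) := MeasurableEquiv.piCongrLeft (fun _ : Fin N => ℝ) e.symm
    with hL_def
  have hL : MeasurePreserving L volume volume :=
    volume_measurePreserving_piCongrLeft (fun _ : Fin N => ℝ) e.symm
  have hLapply : ∀ z : Fin N → ℝ, L z = fun i => z (e i) := by
    intro z
    funext i
    have h := Equiv.piCongrLeft_apply_apply (fun _ : Fin N => ℝ) e.symm z (e i)
    rw [hL_def, MeasurableEquiv.coe_piCongrLeft]
    simpa using h
  have hpre : L ⁻¹' {x : Fin N → ℝ | ∀ i, x i ∈ Ioo (0 : ℝ) 1} =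
      {x : Fin N → ℝ | ∀ i, x i ∈ Ioo (0 : ℝ) 1} := by
    ext z
    rw [mem_preimage, hLapply]
    exact comp_perm_mem_setOf_iff e z
  have h := (hL.integrableOn_comp_preimage L.measurableEmbedding (f := f)
    (s := {x : Fin N → ℝ | ∀ i, x i ∈ Ioo (0 : ℝ) 1})).mpr hf
  rw [hpre] at h
  exact h.congr_fun (fun z _ => by simp only [Function.comp_apply, hLapply])
    (KZ.isOpen_unitCube N).measurableSet

/-- Updating the inserted coordinate. [folklore] -/
theorem update_insertNth (k : Fin (d + 1)) (t s : ℝ) (y : Fin d → ℝ) :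
    Function.update (Fin.insertNth k t y : Fin (d + 1) → ℝ) k s = Fin.insertNth k s y := by
  funext i
  rcases Fin.eq_self_or_eq_succAbove k i with rfl | ⟨j, rfl⟩
  · simp [Fin.insertNth_apply_same]
  · rw [Function.update_of_ne (Fin.succAbove_ne k j)]
    simp [Fin.insertNth_apply_succAbove]

/-- Inserting a coordinate in `(0,1)` into a point of the open `d`-cube gives a point of the open
`(d+1)`-cube. [folklore] -/
theorem insertNth_mem_setOf (k : Fin (d + 1)) {t : ℝ} (ht : t ∈ Ioo (0 : ℝ) 1) {y : Fin d → ℝ}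
    (hy : y ∈ {y : Fin d → ℝ | ∀ i, y i ∈ Ioo (0 : ℝ) 1}) :
    (Fin.insertNth k t y : Fin (d + 1) → ℝ) ∈ {x : Fin (d + 1) → ℝ | ∀ i, x i ∈ Ioo (0 : ℝ) 1} := by
  simp only [mem_setOf_eq] at hy ⊢
  intro i
  rcases Fin.eq_self_or_eq_succAbove k i with rfl | ⟨j, rfl⟩
  · simpa [Fin.insertNth_apply_same] using ht
  · simpa [Fin.insertNth_apply_succAbove] using hy j

/-- Inserting a coordinate in `[0,1]` into a point of the open `d`-cube gives a point of the
closed `(d+1)`-cube. [folklore] -/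
theorem insertNth_mem_Icc_of_mem_setOf (k : Fin (d + 1)) {c : ℝ} (hc : c ∈ Icc (0 : ℝ) 1)
    {y : Fin d → ℝ} (hy : y ∈ {y : Fin d → ℝ | ∀ i, y i ∈ Ioo (0 : ℝ) 1}) :
    (Fin.insertNth k c y : Fin (d + 1) → ℝ) ∈ Icc (0 : Fin (d + 1) → ℝ) 1 := by
  simp only [mem_setOf_eq] at hy
  rw [mem_Icc, Pi.le_def, Pi.le_def]
  constructor
  · intro i
    rcases Fin.eq_self_or_eq_succAbove k i with rfl | ⟨j, rfl⟩
    · simpa [Fin.insertNth_apply_same] using hc.1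
    · simpa [Fin.insertNth_apply_succAbove] using (hy j).1.le
  · intro i
    rcases Fin.eq_self_or_eq_succAbove k i with rfl | ⟨j, rfl⟩
    · simpa [Fin.insertNth_apply_same] using hc.2
    · simpa [Fin.insertNth_apply_succAbove] using (hy j).2.le

/-- Inserting a coordinate in `[0,1]` into a point of the closed `d`-cube gives a point of the
closed `(d+1)`-cube. [folklore] -/
theorem insertNth_mem_Icc_of_mem_Icc (k : Fin (d + 1)) {c : ℝ} (hc : c ∈ Icc (0 : ℝ) 1)
    {y : Fin d → ℝ} (hy : y ∈ Icc (0 : Fin d → ℝ) 1) :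
    (Fin.insertNth k c y : Fin (d + 1) → ℝ) ∈ Icc (0 : Fin (d + 1) → ℝ) 1 := by
  rw [mem_Icc, Pi.le_def, Pi.le_def] at hy ⊢
  obtain ⟨h0, h1⟩ := hy
  constructor
  · intro i
    rcases Fin.eq_self_or_eq_succAbove k i with rfl | ⟨j, rfl⟩
    · simpa [Fin.insertNth_apply_same] using hc.1
    · simpa [Fin.insertNth_apply_succAbove] using h0 j
  · intro i
    rcases Fin.eq_self_or_eq_succAbove k i with rfl | ⟨j, rfl⟩
    · simpa [Fin.insertNth_apply_same] using hc.2
    · simpa [Fin.insertNth_apply_succAbove] using h1 j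

/-- The face embedding `y ↦ insertNth k c y` (rational `c`) is a `ℚ`-semialgebraic map on every
`ℚ`-semialgebraic set: its coordinates are the constant `c` and the coordinate functions.
[folklore] -/
theorem isSemialgebraicMapOn_insertNth (k : Fin (d + 1)) (c : ℚ) {σ : Set (Fin d → ℝ)}
    (hσ : IsSemialgebraic ℚ σ) :
    IsSemialgebraicMapOn ℚ σ (fun y : Fin d → ℝ => (Fin.insertNth k (c : ℝ) y : Fin (d + 1) → ℝ)) := by
  refine IsSemialgebraicMapOn.of_forall hσ fun j => ?_
  rcases Fin.eq_self_or_eq_succAbove k j with rfl | ⟨i, rfl⟩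
  · simp only [Fin.insertNth_apply_same]
    exact isSemialgebraicFunOn_ratCast hσ c
  · simp only [Fin.insertNth_apply_succAbove]
    exact isSemialgebraicFunOn_apply hσ i

/-- The face embedding `y ↦ insertNth k c y` is continuous. [folklore] -/
theorem continuous_insertNth_right (k : Fin (d + 1)) (c : ℝ) :
    Continuous (fun y : Fin d → ℝ => (Fin.insertNth k c y : Fin (d + 1) → ℝ)) := by
  refine continuous_pi fun j => ?_
  rcases Fin.eq_self_or_eq_succAbove k j with rfl | ⟨i, rfl⟩
  · simp only [Fin.insertNth_apply_same]
    exact continuous_const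
  · simp only [Fin.insertNth_apply_succAbove]
    exact continuous_apply i

/-- **Honest face representations.** For `B` `ℚ`-semialgebraic and continuous on the closed unit
`(d+1)`-cube and a rational height `c ∈ [0,1]`, the face function `y ↦ B (insertNth k c y)` is the
integrand of a representation on the open unit `d`-cube (semialgebraic by composition with the
polynomial face embedding; integrable because continuous on the compact closed `d`-cube).
[folklore] -/
theorem exists_faceRep (k : Fin (d + 1)) (c : ℚ) (hc : ((c : ℝ)) ∈ Icc (0 : ℝ) 1)
    {B : (Fin (d + 1) → ℝ) → ℝ} (hB : IsSemialgebraicFunOn ℚ (Icc (0 : Fin (d + 1) → ℝ) 1) B)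
    (hBc : ContinuousOn B (Icc (0 : Fin (d + 1) → ℝ) 1)) :
    ∃ r : KZ.IntegralRep d, r.domain = {y : Fin d → ℝ | ∀ i, y i ∈ Ioo (0 : ℝ) 1} ∧
      r.integrand = fun y => B (Fin.insertNth k (c : ℝ) y) := by
  have hUd : IsSemialgebraic ℚ {y : Fin d → ℝ | ∀ i, y i ∈ Ioo (0 : ℝ) 1} :=
    KZ.isSemialgebraic_unitCube d
  have hsa : IsSemialgebraicFunOn ℚ {y : Fin d → ℝ | ∀ i, y i ∈ Ioo (0 : ℝ) 1}
      (fun y => B (Fin.insertNth k (c : ℝ) y)) :=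
    (IsSemialgebraicFunOn.comp_isSemialgebraicMapOn_holds hB (isSemialgebraicMapOn_insertNth k c hUd)
      fun y hy => insertNth_mem_Icc_of_mem_setOf k hc hy).congr fun _ _ => rfl
  have hcont : ContinuousOn (fun y => B (Fin.insertNth k (c : ℝ) y)) (Icc (0 : Fin d → ℝ) 1) :=
    hBc.comp (continuous_insertNth_right k c).continuousOn
      fun y hy => insertNth_mem_Icc_of_mem_Icc k hc hy
  have hint : IntegrableOn (fun y => B (Fin.insertNth k (c : ℝ) y))
      {y : Fin d → ℝ | ∀ i, y i ∈ Ioo (0 : ℝ) 1} :=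
    (hcont.integrableOn_compact isCompact_Icc).mono_set (KZ.unitCube_subset_Icc d)
  exact ⟨⟨_, _, hUd, hsa, hint⟩, rfl, rfl⟩


end Summit.KontsevichZagierPeriods.GenericPointClass.ExactDescentBox
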